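import Literature.AlgebraicGeometry.Resolution.BlowupChartRegular
import Literature.AlgebraicGeometry.Resolution.HypersurfaceTransformChart
import Literature.AlgebraicGeometry.Resolution.RegularLocalRingsQuotient
import Mathlib.RingTheory.Regular.Flat
import HarnessLib

/-!
# Crux `PatchingRelPerfect` (stmt-ResolutionOfSingularities-16161), chain w52 — rung toolkit:
# regularity of QUOTIENTS of blow-up chart rings, prime by prime

[OURS · L1 W5.2 · rung tool] The chartwise assembly (`…PointBlowupChartAssembly.lean`) and Liu's
theorem on affine charts (`isRegular_of_isBlowup_idealSheaf_of_quotient`) reduce a rung to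
statements `IsRegularRing (B ⧸ 𝔫)` for centres `𝔫` on Rees charts `B`.  When `𝔫` contains the
exceptional parameter these are polynomial computations (`chartQuotEquiv`, `chartStageEquiv`);
the first centre that is NOT of this kind (rung r2pt: the strict transform of the quadric cone,
`𝔫 = (u₂, G̃)` on a third-level chart) needs the three prime-by-prime tools PROVED here, for
arbitrary commutative rings:

* `isRegularLocalRing_localization_quotient_iff` — localisation at a prime commutes with
  quotients: `(A/J)_{Q/J}` is regular iff `A_Q / J A_Q` is;
* `isRegularLocalRing_localization_quotient_of_notMem_sq`, and the Jacobian criterion on a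
  polynomial ring `MvPolynomial.isRegularLocalRing_localization_quotient_of_pderiv_notMem` /
  `MvPolynomial.isRegularRing_quotient_of_pderiv` — a hypersurface `V(F)` in a regular ring is
  regular at every prime not containing some partial derivative of `F`
  (tree: `notMem_sq_maximalIdeal_of_pderiv_notMem`, `IsRegularLocalRing.quotient_span_singleton`);
* `isRegularLocalRing_localization_quotient_of_isWeaklyRegular_cons` — ON a hypersurface
  `V(g)`: if `(g, j₁, …, j_r)` is a weakly regular sequence of the Noetherian ring `D` and
  `D ⧸ (g, j)` is a regular ring, then `D ⧸ (j)` is regular at every prime containing `g`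
  (regular sequences permute in local rings, Mathlib `IsLocalRing.isRegular_of_perm`, and
  regularity lifts modulo a regular element, tree `isRegularLocalRing_of_quotient_span_singleton`);
* `isRegularLocalRing_localization_quotient_of_notMem_of_away` — OFF a hypersurface `V(g)`
  whose complement `D[1/g]` is a localisation `A[1/a]` of another ring: if `J D[1/g] = J₀ A[1/a]`
  and `A ⧸ J₀` is regular at the primes not containing `a`, then `D ⧸ J` is regular at the primes
  not containing `g` (the quotient version of the tree's
  `isRegularLocalRing_localization_of_not_mem_of_away`).

Nothing here is a statement of the manuscript under review.

## References

* H. Matsumura, *Commutative Ring Theory*, CUP 1986, Thms. 14.2, 16.3, 19.2. [Matsumura1987]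
* The Stacks Project, Tags 00NQ, 07Z3. [StacksProject]
-/

-- `Summit.<Summit>.<Sub>.Theorems` with `Sub = Summit` (single-conjunct summit, D-0017)
set_option linter.dupNamespace false

noncomputable section

open IsLocalRing Literature.AlgebraicGeometry.Resolution

namespace Summit.ResolutionOfSingularities.ResolutionOfSingularities.Theorems

universe u

/-! ## Localisation at a prime commutes with quotients -/

section QuotLoc

variable {A : Type u} [CommRing A] (J : Ideal A) (Q : Ideal A) [Q.IsPrime] (Qbar : Ideal (A ⧸ J))
  [Qbar.IsPrime] (hQ : Qbar.comap (Ideal.Quotient.mk J) = Q)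

include hQ in
/-- The image of the complement of `Q = π⁻¹(Q̄)` in `A/J` is the complement of `Q̄`. [folklore] -/
theorem algebraMapSubmonoid_primeCompl_eq :
    Algebra.algebraMapSubmonoid (A ⧸ J) Q.primeCompl = Qbar.primeCompl := by
  subst hQ
  ext b
  constructor
  · rintro ⟨c, hc, rfl⟩
    exact fun h => hc (Ideal.mem_comap.mpr h)
  · intro hb
    obtain ⟨c, rfl⟩ := Ideal.Quotient.mk_surjective b
    exact ⟨c, fun h => hb (Ideal.mem_comap.mp h), rfl⟩

include hQ in
/-- **`(A/J)_{Q̄}` is the localisation `A_Q ⧸ J A_Q`** (`Q = π⁻¹ Q̄`): localisation at a prime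
commutes with quotients. [cite: StacksProject, Tag 00NQ (proof)] -/
theorem isLocalization_atPrime_localization_quotient :
    IsLocalization.AtPrime (Localization.AtPrime Q ⧸ J.map (algebraMap A (Localization.AtPrime Q)))
      Qbar := by
  have := (inferInstance : IsLocalization (Algebra.algebraMapSubmonoid (A ⧸ J) Q.primeCompl)
    (Localization.AtPrime Q ⧸ J.map (algebraMap A (Localization.AtPrime Q))))
  rwa [algebraMapSubmonoid_primeCompl_eq J Q Qbar hQ] at this

include hQ in
/-- The ring isomorphism `(A/J)_{Q̄} ≅ A_Q ⧸ J A_Q`. [cite: StacksProject, Tag 00NQ (proof)] -/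
theorem nonempty_localization_quotient_equiv :
    Nonempty (Localization.AtPrime Qbar ≃+*
      Localization.AtPrime Q ⧸ J.map (algebraMap A (Localization.AtPrime Q))) := by
  haveI := isLocalization_atPrime_localization_quotient J Q Qbar hQ
  exact ⟨(IsLocalization.algEquiv Qbar.primeCompl (Localization.AtPrime Qbar)
    (Localization.AtPrime Q ⧸ J.map (algebraMap A (Localization.AtPrime Q)))).toRingEquiv⟩

include hQ in
/-- **Regularity of `A/J` at `Q̄` is regularity of `A_Q ⧸ J A_Q`.** [folklore] -/
theorem isRegularLocalRing_localization_quotient_iff :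
    IsRegularLocalRing (Localization.AtPrime Qbar) ↔
      IsRegularLocalRing
        (Localization.AtPrime Q ⧸ J.map (algebraMap A (Localization.AtPrime Q))) := by
  obtain ⟨e⟩ := nonempty_localization_quotient_equiv J Q Qbar hQ
  exact ⟨fun _ => IsRegularLocalRing.of_ringEquiv e,
    fun _ => IsRegularLocalRing.of_ringEquiv e.symm⟩

omit [Q.IsPrime] in
/-- For `J ≤ Q`: `Q/J` is prime and pulls back to `Q`. [folklore] -/
theorem isPrime_map_mk_and_comap_eq (hJQ : J ≤ Q) [Q.IsPrime] :
    (Q.map (Ideal.Quotient.mk J)).IsPrime ∧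
      (Q.map (Ideal.Quotient.mk J)).comap (Ideal.Quotient.mk J) = Q := by
  refine ⟨Ideal.map_isPrime_of_surjective Ideal.Quotient.mk_surjective (by rwa [Ideal.mk_ker]), ?_⟩
  rw [Ideal.comap_map_of_surjective _ Ideal.Quotient.mk_surjective, ← RingHom.ker_eq_comap_bot,
    Ideal.mk_ker, sup_eq_left]
  exact hJQ

end QuotLoc

/-! ## Hypersurfaces: the element-of-order-one criterion and the Jacobian criterion -/

/-- **A regular local ring modulo an element of order one, read on `A/(f)`**: if `A_Q` is a
regular local ring and the image of `f ∈ Q` in `A_Q` is not in `𝔪²`, then `(A/(f))_{Q̄}` is a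
regular local ring (Matsumura Thm. 14.2, tree `IsRegularLocalRing.quotient_span_singleton`).
[cite: Matsumura1987, Thm. 14.2] -/
theorem isRegularLocalRing_localization_quotient_of_notMem_sq {A : Type u} [CommRing A] {f : A}
    (Qbar : Ideal (A ⧸ Ideal.span {f})) [Qbar.IsPrime]
    [hreg : IsRegularLocalRing
      (Localization.AtPrime (Qbar.comap (Ideal.Quotient.mk (Ideal.span {f}))))]
    (hf2 : algebraMap A (Localization.AtPrime (Qbar.comap (Ideal.Quotient.mk (Ideal.span {f})))) f
      ∉ maximalIdeal _ ^ 2) :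
    IsRegularLocalRing (Localization.AtPrime Qbar) := by
  set Q : Ideal A := Qbar.comap (Ideal.Quotient.mk (Ideal.span {f})) with hQ
  set L := Localization.AtPrime Q
  have hfQ : f ∈ Q := by
    rw [hQ, Ideal.mem_comap, Ideal.Quotient.eq_zero_iff_mem.mpr (Ideal.mem_span_singleton_self f)]
    exact Qbar.zero_mem
  have hfm : algebraMap A L f ∈ maximalIdeal L := by
    rw [← Localization.AtPrime.map_eq_maximalIdeal]
    exact Ideal.mem_map_of_mem _ hfQ
  have h := (IsRegularLocalRing.quotient_span_singleton hfm hf2).1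
  have hJ : (Ideal.span {f}).map (algebraMap A L) = Ideal.span {algebraMap A L f} := by
    rw [Ideal.map_span, Set.image_singleton]
  rw [isRegularLocalRing_localization_quotient_iff (Ideal.span {f}) Q Qbar rfl, hJ]
  exact h

/-- **Jacobian criterion, pointwise**: for a polynomial `F` over a commutative ring `k` with
`k[T]` regular, the hypersurface ring `k[T]/(F)` is a regular local ring at every prime `Q̄` not
containing the class of some partial derivative `∂F/∂T_j` (the derivation `∂/∂T_j` shows
`F ∉ 𝔪_Q²`, tree `notMem_sq_maximalIdeal_of_pderiv_notMem`). [cite: Matsumura1987, Thm. 14.2] -/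
theorem MvPolynomial.isRegularLocalRing_localization_quotient_of_pderiv_notMem {σ : Type u}
    {k : Type u} [CommRing k] [IsRegularRing (MvPolynomial σ k)] {F : MvPolynomial σ k}
    (Qbar : Ideal (MvPolynomial σ k ⧸ Ideal.span {F})) [Qbar.IsPrime] (j : σ)
    (hj : Ideal.Quotient.mk (Ideal.span {F}) (MvPolynomial.pderiv j F) ∉ Qbar) :
    IsRegularLocalRing (Localization.AtPrime Qbar) := by
  classical
  set Q : Ideal (MvPolynomial σ k) := Qbar.comap (Ideal.Quotient.mk (Ideal.span {F})) with hQ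
  have hj' : (RingHom.id (MvPolynomial σ k)) (MvPolynomial.pderiv j F) ∉ Q := fun h =>
    hj (Ideal.mem_comap.mp h)
  have hf2 := notMem_sq_maximalIdeal_of_pderiv_notMem (RingHom.id (MvPolynomial σ k))
    Function.surjective_id ⊥
    (by intro p hp; rw [RingHom.mem_ker, RingHom.id_apply] at hp; rw [hp]; exact zero_mem _) Q
    (fun a ha => by rw [(Submodule.mem_bot k).mp ha, map_zero, map_zero]; exact Q.zero_mem)
    j F hj'
  exact isRegularLocalRing_localization_quotient_of_notMem_sq Qbar hf2

/-- **Jacobian criterion, global**: if at every prime containing `F` some partial derivative of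
`F` is non-zero, then `k[T]/(F)` is a regular ring (for `k[T]` regular, e.g. `k` a field or any
regular ring and finitely many variables). [cite: Matsumura1987, Thm. 14.2] -/
theorem MvPolynomial.isRegularRing_quotient_of_pderiv {σ : Type u} {k : Type u} [CommRing k]
    [IsRegularRing (MvPolynomial σ k)] {F : MvPolynomial σ k}
    (h : ∀ (Q : Ideal (MvPolynomial σ k)), Q.IsPrime → F ∈ Q →
      ∃ j, MvPolynomial.pderiv j F ∉ Q) :
    IsRegularRing (MvPolynomial σ k ⧸ Ideal.span {F}) := by
  haveI : IsNoetherianRing (MvPolynomial σ k ⧸ Ideal.span {F}) :=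
    Ideal.Quotient.isNoetherianRing _
  rw [isRegularRing_iff]
  intro Qbar hQbar
  set Q : Ideal (MvPolynomial σ k) := Qbar.comap (Ideal.Quotient.mk (Ideal.span {F}))
  have hFQ : F ∈ Q := by
    change Ideal.Quotient.mk (Ideal.span {F}) F ∈ Qbar
    rw [Ideal.Quotient.eq_zero_iff_mem.mpr (Ideal.mem_span_singleton_self F)]
    exact Qbar.zero_mem
  obtain ⟨j, hj⟩ := h Q inferInstance hFQ
  exact MvPolynomial.isRegularLocalRing_localization_quotient_of_pderiv_notMem Qbar j
    (fun hm => hj (Ideal.mem_comap.mpr hm))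


/-! ## On a hypersurface: quotients by the tail of a regular sequence -/

/-- **Regularity of `D ⧸ (j₁, …, j_r)` at the primes containing `g`, from the regular sequence
`(g, j₁, …, j_r)`**: if `D` is Noetherian, `(g, j₁, …, j_r)` is a weakly regular sequence on `D`
and `D ⧸ (g, j₁, …, j_r)` is a regular ring, then `(D ⧸ (j))_{Q̄}` is a regular local ring for
every prime `Q̄ ∋ ḡ`.  Proof: in the local ring `D_Q` the sequence stays regular
(Mathlib `IsWeaklyRegular.isRegular_of_isLocalization_of_mem`) and may be permuted to
`(j₁, …, j_r, g)` (Matsumura Thm. 16.3, Mathlib `IsLocalRing.isRegular_of_perm`); so `g` is a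
non-zero-divisor of `D_Q ⧸ (j) D_Q` with regular quotient `(D ⧸ (g, j))_{…}`, and regularity lifts
(tree `isRegularLocalRing_of_quotient_span_singleton`). [cite: Matsumura1987, Thm. 16.3] -/
theorem isRegularLocalRing_localization_quotient_of_isWeaklyRegular_cons {D : Type u} [CommRing D]
    [IsNoetherianRing D] (g : D) (js : List D)
    (hreg : RingTheory.Sequence.IsWeaklyRegular D (g :: js))
    [hq : IsRegularRing (D ⧸ Ideal.ofList (g :: js))]
    (Qbar : Ideal (D ⧸ Ideal.ofList js)) [Qbar.IsPrime]
    (hg : Ideal.Quotient.mk (Ideal.ofList js) g ∈ Qbar) :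
    IsRegularLocalRing (Localization.AtPrime Qbar) := by
  set Q : Ideal D := Qbar.comap (Ideal.Quotient.mk (Ideal.ofList js)) with hQ
  haveI hQp : Q.IsPrime := by rw [hQ]; infer_instance
  let L := Localization.AtPrime Q
  have hgQ : g ∈ Q := Ideal.mem_comap.mpr hg
  have hJQ : Ideal.ofList js ≤ Q := fun x hx => by
    rw [hQ, Ideal.mem_comap, Ideal.Quotient.eq_zero_iff_mem.mpr hx]
    exact Qbar.zero_mem
  have hmem : ∀ r ∈ g :: js, r ∈ Q := by
    intro r hr
    rcases List.mem_cons.mp hr with rfl | hr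
    · exact hgQ
    · exact hJQ (Ideal.subset_span hr)
  -- regular sequence in the local ring `L = D_Q`, permuted to `(j, g)`
  have h1 : RingTheory.Sequence.IsRegular L ((g :: js).map (algebraMap D L)) :=
    hreg.isRegular_of_isLocalization_of_mem L Q hmem
  have h2 : RingTheory.Sequence.IsRegular L (js.map (algebraMap D L) ++ [algebraMap D L g]) := by
    refine IsLocalRing.isRegular_of_perm h1 ?_
    rw [List.map_cons]
    exact (List.perm_append_singleton _ _).symm
  have h3 := ((RingTheory.Sequence.isWeaklyRegular_append_iff L _ _).mp h2.toIsWeaklyRegular).2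
  rw [RingTheory.Sequence.isWeaklyRegular_singleton_iff] at h3
  -- `g` is a non-zero-divisor of `L ⧸ J L`
  set JL : Ideal L := (Ideal.ofList js).map (algebraMap D L) with hJL
  have hK : (Ideal.ofList (js.map (algebraMap D L)) • ⊤ : Submodule L L) = JL := by
    rw [smul_eq_mul, Ideal.mul_top, hJL, Ideal.map_ofList]
  have h3' : IsSMulRegular (L ⧸ JL) (algebraMap D L g) :=
    ((Submodule.quotEquivOfEq _ _ hK).isSMulRegular_congr _).mp h3
  set t : L ⧸ JL := Ideal.Quotient.mk JL (algebraMap D L g) with htdef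
  have ht : t ∈ nonZeroDivisors (L ⧸ JL) := by
    refine mem_nonZeroDivisors_iff_right.mpr fun x hx => ?_
    obtain ⟨x, rfl⟩ := Ideal.Quotient.mk_surjective x
    have h0 : algebraMap D L g • Ideal.Quotient.mk JL x = algebraMap D L g • (0 : L ⧸ JL) := by
      rw [smul_zero, ← Ideal.Quotient.mk_eq_mk, ← Submodule.Quotient.mk_smul,
        Ideal.Quotient.mk_eq_mk, smul_eq_mul, map_mul, mul_comm, ← htdef]
      exact hx
    exact h3' h0
  -- `L ⧸ J L` is local Noetherian with `t` in the maximal ideal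
  have hJLle : JL ≤ maximalIdeal L := by
    rw [hJL, ← Localization.AtPrime.map_eq_maximalIdeal]
    exact Ideal.map_mono hJQ
  have hJLne : JL ≠ ⊤ := fun h => (maximalIdeal.isMaximal L).ne_top (top_le_iff.mp (h ▸ hJLle))
  haveI : IsLocalRing (L ⧸ JL) := isLocalRing_quotient hJLne
  haveI : IsNoetherianRing (L ⧸ JL) := Ideal.Quotient.isNoetherianRing _
  haveI : Nontrivial (L ⧸ JL) := Ideal.Quotient.nontrivial_iff.mpr hJLne
  have hgm : algebraMap D L g ∈ maximalIdeal L := by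
    rw [← Localization.AtPrime.map_eq_maximalIdeal]
    exact Ideal.mem_map_of_mem _ hgQ
  have htm : t ∈ maximalIdeal (L ⧸ JL) := by
    rw [maximalIdeal_quotient_eq_map JL]
    exact Ideal.mem_map_of_mem _ hgm
  -- `(L ⧸ JL) ⧸ (t) ≅ L ⧸ (g, j) L ≅ (D ⧸ (g, j))_{Q̄₂}` is regular
  set J₂ : Ideal D := Ideal.ofList (g :: js) with hJ₂def
  have hJ₂Q : J₂ ≤ Q := by
    rw [hJ₂def, Ideal.ofList, Ideal.span_le]
    exact fun r hr => hmem r hr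
  obtain ⟨hP₂, hQ₂⟩ := isPrime_map_mk_and_comap_eq J₂ Q hJ₂Q
  haveI := hP₂
  have hregL : IsRegularLocalRing (L ⧸ J₂.map (algebraMap D L)) :=
    (isRegularLocalRing_localization_quotient_iff J₂ Q _ hQ₂).mp inferInstance
  have hJ₂L : J₂.map (algebraMap D L) = JL ⊔ Ideal.span {algebraMap D L g} := by
    rw [hJ₂def, Ideal.ofList_cons, Ideal.map_sup, Ideal.map_span, Set.image_singleton, sup_comm]
  have h1 : Ideal.span {t} = (Ideal.span {algebraMap D L g}).map (Ideal.Quotient.mk JL) := by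
    rw [Ideal.map_span, Set.image_singleton]
  have e : (L ⧸ JL) ⧸ Ideal.span {t} ≃+* L ⧸ J₂.map (algebraMap D L) :=
    (Ideal.quotEquivOfEq h1).trans ((DoubleQuot.quotQuotEquivQuotSup JL
      (Ideal.span {algebraMap D L g})).trans (Ideal.quotEquivOfEq hJ₂L.symm))
  haveI : IsRegularLocalRing ((L ⧸ JL) ⧸ Ideal.span {t}) :=
    (letI := hregL; IsRegularLocalRing.of_ringEquiv e.symm)
  have hS : IsRegularLocalRing (L ⧸ JL) := isRegularLocalRing_of_quotient_span_singleton ht htm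
  exact (isRegularLocalRing_localization_quotient_iff (Ideal.ofList js) Q Qbar rfl).mpr hS


/-! ## Off a hypersurface whose complement is a localisation of another ring -/

/-- **Regularity of `D ⧸ J` at the primes not containing `g`, transported from `A ⧸ J₀`**, when
`T = D[1/g] = A[1/a]` is a common localisation (both algebra structures on `T`) and
`J T = J₀ T`: for a prime `Q̄ ∌ ḡ` of `D ⧸ J` one has `(D/J)_{Q̄} ≅ D_Q/J ≅ T_{QT}/J₀ ≅ A_q/J₀ ≅
(A/J₀)_{q̄}` with `q = QT ∩ A ∌ a`.  The case `J = J₀ = 0` is the tree's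
`isRegularLocalRing_localization_of_not_mem_of_away`; the intended use is a Rees chart
`D = (A[It])_{(at)}` with `D[1/a] = A[1/a]` (Stacks 07Z3 (3)). [cite: StacksProject, Tag 07Z3] -/
theorem isRegularLocalRing_localization_quotient_of_notMem_of_away {A D T : Type u} [CommRing A]
    [CommRing D] [CommRing T] [Algebra A T] (a : A) [IsLocalization.Away a T] [Algebra D T]
    (g : D) [IsLocalization.Away g T] (J₀ : Ideal A) (J : Ideal D)
    (hJ : J.map (algebraMap D T) = J₀.map (algebraMap A T))
    (hA : ∀ (P : Ideal (A ⧸ J₀)) [P.IsPrime], Ideal.Quotient.mk J₀ a ∉ P →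
      IsRegularLocalRing (Localization.AtPrime P))
    (Qbar : Ideal (D ⧸ J)) [Qbar.IsPrime] (hg : Ideal.Quotient.mk J g ∉ Qbar) :
    IsRegularLocalRing (Localization.AtPrime Qbar) := by
  set Q : Ideal D := Qbar.comap (Ideal.Quotient.mk J) with hQ
  haveI hQp : Q.IsPrime := by rw [hQ]; infer_instance
  have hgQ : g ∉ Q := fun h => hg (Ideal.mem_comap.mp h)
  have hJQ : J ≤ Q := fun x hx => by
    rw [hQ, Ideal.mem_comap, Ideal.Quotient.eq_zero_iff_mem.mpr hx]
    exact Qbar.zero_mem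
  have hdisj : Disjoint (Submonoid.powers g : Set D) (Q : Set D) := by
    rw [Set.disjoint_left]
    rintro _ ⟨n, rfl⟩ h
    exact hgQ (hQp.mem_of_pow_mem n h)
  set Q' : Ideal T := Q.map (algebraMap D T) with hQ'
  haveI hQ'p : Q'.IsPrime :=
    IsLocalization.isPrime_of_isPrime_disjoint (Submonoid.powers g) _ Q hQp hdisj
  have hQ'c : Q'.comap (algebraMap D T) = Q :=
    IsLocalization.under_map_of_isPrime_disjoint (Submonoid.powers g) _ hQp hdisj
  -- `T_{Q'}` is `D_Q` …
  haveI h1 : IsLocalization.AtPrime (Localization.AtPrime Q') Q := by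
    have := IsLocalization.isLocalization_isLocalization_atPrime_isLocalization
      (Submonoid.powers g) (Localization.AtPrime Q') Q'
    have key : (Q'.comap (algebraMap D T)).primeCompl = Q.primeCompl := by
      ext c
      change c ∉ Q'.comap (algebraMap D T) ↔ c ∉ Q
      rw [hQ'c]
    dsimp only [IsLocalization.AtPrime] at this ⊢
    rwa [key] at this
  -- … and `A_q`, `q = Q' ∩ A ∌ a`, `q ⊇ J₀`
  set q : Ideal A := Q'.comap (algebraMap A T) with hq
  haveI h2 : IsLocalization.AtPrime (Localization.AtPrime Q') q :=
    IsLocalization.isLocalization_isLocalization_atPrime_isLocalization (Submonoid.powers a)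
      (Localization.AtPrime Q') Q'
  have haq : a ∉ q := fun h => hQ'p.ne_top
    (Ideal.eq_top_of_isUnit_mem _ (Ideal.mem_comap.mp h) (IsLocalization.Away.algebraMap_isUnit a))
  have hJ₀q : J₀ ≤ q := by
    intro x hx
    rw [hq, Ideal.mem_comap]
    have hx' : algebraMap A T x ∈ J₀.map (algebraMap A T) := Ideal.mem_map_of_mem _ hx
    rw [← hJ] at hx'
    exact Ideal.map_mono hJQ hx'
  -- the quotient `A_q ⧸ J₀ A_q ≅ (A ⧸ J₀)_{q̄}` is regular by hypothesis
  obtain ⟨hPq, hqc⟩ := isPrime_map_mk_and_comap_eq J₀ q hJ₀q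
  haveI := hPq
  have hnot : Ideal.Quotient.mk J₀ a ∉ q.map (Ideal.Quotient.mk J₀) := fun h =>
    haq (by rw [← hqc]; exact Ideal.mem_comap.mpr h)
  have hregq : IsRegularLocalRing
      (Localization.AtPrime q ⧸ J₀.map (algebraMap A (Localization.AtPrime q))) :=
    (isRegularLocalRing_localization_quotient_iff J₀ q _ hqc).mp (hA _ hnot)
  -- transport `D_Q ⧸ J D_Q ≅ T_{Q'} ⧸ J T_{Q'} = T_{Q'} ⧸ J₀ T_{Q'} ≅ A_q ⧸ J₀ A_q`
  let e1 : Localization.AtPrime Q ≃ₐ[D] Localization.AtPrime Q' :=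
    IsLocalization.algEquiv Q.primeCompl _ _
  let e2 : Localization.AtPrime Q' ≃ₐ[A] Localization.AtPrime q :=
    IsLocalization.algEquiv q.primeCompl _ _
  have hc1 : (e1.toRingEquiv : Localization.AtPrime Q →+* Localization.AtPrime Q').comp
      (algebraMap D (Localization.AtPrime Q)) = algebraMap D (Localization.AtPrime Q') :=
    RingHom.ext fun x => e1.commutes x
  have hc2 : (e2.toRingEquiv : Localization.AtPrime Q' →+* Localization.AtPrime q).comp
      (algebraMap A (Localization.AtPrime Q')) = algebraMap A (Localization.AtPrime q) :=
    RingHom.ext fun x => e2.commutes x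
  have hm1 : J.map (algebraMap D (Localization.AtPrime Q')) =
      (J.map (algebraMap D (Localization.AtPrime Q))).map
        (e1.toRingEquiv : Localization.AtPrime Q →+* Localization.AtPrime Q') := by
    rw [Ideal.map_map, hc1]
  have hmid : J.map (algebraMap D (Localization.AtPrime Q')) =
      J₀.map (algebraMap A (Localization.AtPrime Q')) := by
    rw [IsScalarTower.algebraMap_eq D T (Localization.AtPrime Q'), ← Ideal.map_map, hJ,
      Ideal.map_map, ← IsScalarTower.algebraMap_eq]
  have hm2 : J₀.map (algebraMap A (Localization.AtPrime q)) =
      (J₀.map (algebraMap A (Localization.AtPrime Q'))).map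
        (e2.toRingEquiv : Localization.AtPrime Q' →+* Localization.AtPrime q) := by
    rw [Ideal.map_map, hc2]
  have e : Localization.AtPrime Q ⧸ J.map (algebraMap D (Localization.AtPrime Q)) ≃+*
      Localization.AtPrime q ⧸ J₀.map (algebraMap A (Localization.AtPrime q)) :=
    (Ideal.quotientEquiv _ _ e1.toRingEquiv hm1).trans
      ((Ideal.quotEquivOfEq hmid).trans (Ideal.quotientEquiv _ _ e2.toRingEquiv hm2))
  haveI : IsRegularLocalRing
      (Localization.AtPrime Q ⧸ J.map (algebraMap D (Localization.AtPrime Q))) :=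
    (letI := hregq; IsRegularLocalRing.of_ringEquiv e.symm)
  exact (isRegularLocalRing_localization_quotient_iff J Q Qbar rfl).mpr ‹_›

end Summit.ResolutionOfSingularities.ResolutionOfSingularities.Theorems

end
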